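import Summits.ResolutionOfSingularities.ResolutionOfSingularities.Theorems.EquisingularLiftEquisingularLiftNatEquimultipleAlongTrace
import Mathlib.Algebra.Polynomial.AlgebraMap
import Mathlib.Algebra.MvPolynomial.Equiv
import HarnessLib

/-!
# `EquisingularLiftNat`, line `sections`, stub `stub_elnat_three` — helper AVOID-L1 / M10
# `EquimultipleAlongTrace`, part 2: quasi-regular centres, McCoy, and the regular local ring

[OURS · L1 W4.5b] Continuation of `…Theorems.EquisingularLiftEquisingularLiftNatEquimultipleAlongTrace`
(controlled transform of a normal form, the bad point, AVOID, `z`-saturation) for the research stub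
`stub_elnat_three` / `stub_elnat_three_horiz` of the registered line `sections` of the crux item
`EquisingularLiftNat` = stmt-ResolutionOfSingularities-20038 (chain w45b); NOT a statement of any manuscript.
Closed form M10 `EquimultipleAlongTrace` of tri-1's TRIAGE v3 §−3.B/§3: on the chart `S = 1` (`g = zT`)
of the blow-up of the regular threefold germ along the trace `D = V(z, ḡ)` of a Δ-centre, with `F`
(the hypersurface `Y′`) in normal form `F ≡ Σ_{k ≤ m} a_k z^{m-k} g^k (mod I^{m+1})`, `I = (z, g)`:

* `coeff_zero_mem_of_controlledTransform_mem` — for `I = (x₀, x₁)` QUASI-REGULAR (`z = xᵢ`, `g = x_j`)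
  and an ideal `𝔪 ⊇ I`: `F′ ∈ 𝔪·R[I/z] + (g/z)` ⟹ `a₀ ∈ 𝔪` (the relations of the chart modulo `z`
  come from `I`, Stacks 0BIQ) — converse of `controlledTransform_mem_badPoint`;
* `controlledTransform_regular_mod_of_coeff` — McCoy: if `a₀, …, a_m` have no common annihilator
  modulo `I` (generic multiplicity exactly `m` along every branch of `D`), then `F′` is a
  non-zero-divisor modulo `(z)`, so `(F′)` is the strict transform
  (`ker_mapQuotient_eq_span_of_regular_mod`, part 1 — no primality of `z`, NODAL traces allowed);
* `badPoint_mem_strictTransform_iff` — **M10 on the chart**: `ker(R[I/z] → (R/(F))[Ī/z̄]) ⊆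
  𝔪·R[I/z] + (g/z) ⟺ a₀ ∈ 𝔪`;
* `mem_pow_succ_iff_coeff_zero_mem` — `(R, 𝔪)` regular local, `z` a regular parameter, `g ∈ 𝔪²`:
  `F ∈ 𝔪^{m+1} ⟺ a₀ ∈ 𝔪` (Matsumura Thm. 17.10); `isQuasiRegular_param_pair` — `(z, g)` with
  `g ∉ (z)` is quasi-regular (Thm. 16.2 (i));
* `badPoint_mem_strictTransform_iff_mem_pow_succ` — **AVOID ⟺ EQUIMULTIPLICITY**: the bad point
  `b_q = (𝔪, g/z)` lies on the strict transform of `Y′` iff `F ∈ 𝔪^{m+1}`, i.e. iff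
  `mult_q(Y′) ≥ m + 1`.

All statements are [folklore]-level commutative algebra; axioms standard. -/

set_option linter.dupNamespace false -- mandated namespace `Summit.<Summit>.<Problem>` of this single-conjunct summit

noncomputable section

namespace Summit.ResolutionOfSingularities.ResolutionOfSingularities.Cruxes.EquisingularLiftNat.Sections

open IsLocalization Literature.AlgebraicGeometry.Resolution

universe u

variable {R : Type u} [CommRing R]

/-! ## Quasi-regular centres `I = (x)`: the converse at the bad point, and regularity modulo `z` -/

section QuasiRegular

variable {r : ℕ} (x : Fin r → R) (i j : Fin r)

/-- The polynomial `Σ_{k ≤ m} a_k T_j^k` lifting the leading form of the normal form to the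
presentation `R[T_l : l ≠ i] → R[I/xᵢ]`. [folklore] -/
theorem eval_sum_C_mul_X_pow (hji : j ≠ i) (m : ℕ) (a : ℕ → R) :
    blowupAlgebra.eval x i (∑ k ∈ Finset.range (m + 1),
        MvPolynomial.C (a k) * MvPolynomial.X (⟨j, hji⟩ : {l : Fin r // l ≠ i}) ^ k) =
      ∑ k ∈ Finset.range (m + 1), algebraMap R _ (a k) * blowupAlgebra.frac x i j ^ k := by
  rw [map_sum]
  refine Finset.sum_congr rfl fun k _ => ?_
  rw [map_mul, map_pow, blowupAlgebra.eval_C, blowupAlgebra.eval_X]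

/-- The constant coefficient of `Σ_{k ≤ m} a_k T_j^k` is `a₀`. [folklore] -/
theorem constantCoeff_sum_C_mul_X_pow (hji : j ≠ i) (m : ℕ) (a : ℕ → R) :
    MvPolynomial.constantCoeff (∑ k ∈ Finset.range (m + 1),
        MvPolynomial.C (a k) * MvPolynomial.X (⟨j, hji⟩ : {l : Fin r // l ≠ i}) ^ k) = a 0 := by
  rw [map_sum, Finset.sum_range_succ']
  simp only [map_mul, map_pow, MvPolynomial.constantCoeff_C, MvPolynomial.constantCoeff_X,
    zero_pow (Nat.succ_ne_zero _), mul_zero, Finset.sum_const_zero, zero_add, pow_zero, mul_one]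

/-- The coefficient of `T_j^k` in `Σ_{l ≤ m} a_l T_j^l` is `a_k` (`k ≤ m`). [folklore] -/
theorem coeff_sum_C_mul_X_pow (hji : j ≠ i) (m : ℕ) (a : ℕ → R) {k : ℕ} (hk : k ∈ Finset.range (m + 1)) :
    MvPolynomial.coeff (Finsupp.single (⟨j, hji⟩ : {l : Fin r // l ≠ i}) k)
        (∑ l ∈ Finset.range (m + 1),
          MvPolynomial.C (a l) * MvPolynomial.X (⟨j, hji⟩ : {l : Fin r // l ≠ i}) ^ l) = a k := by
  classical
  rw [MvPolynomial.coeff_sum]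
  simp only [MvPolynomial.coeff_C_mul, MvPolynomial.coeff_X_pow]
  rw [Finset.sum_eq_single k]
  · rw [if_pos rfl, mul_one]
  · intro l _ hlk
    rw [if_neg (fun h => hlk (Finsupp.single_injective _ h)), mul_zero]
  · exact fun h => (h hk).elim

/-- **The converse at the bad point** (Stacks 0BIQ: the relations of `R[I/xᵢ]` modulo `xᵢ` come from
`I`). For `I = (x₁, …, x_r)` quasi-regular, `z = xᵢ`, `g = x_j` (`j ≠ i`) and an ideal `𝔪 ⊇ I` of `R`:
if the controlled transform lies in `𝔪·R[I/z] + (g/z)` then `a₀ ∈ 𝔪`. [cite: StacksProject, Tag 0BIQ] -/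
theorem coeff_zero_mem_of_controlledTransform_mem (hx : IsQuasiRegular x) (hji : j ≠ i)
    (m : ℕ) (a : ℕ → R) {F : R}
    (hF : F - ∑ k ∈ Finset.range (m + 1), a k * x i ^ (m - k) * x j ^ k ∈
      Ideal.span (Set.range x) ^ (m + 1))
    {F' : blowupAlgebra (Ideal.span (Set.range x)) (x i)}
    (hF' : algebraMap R _ F = algebraMap R _ (x i) ^ m * F')
    (𝔪 : Ideal R) (hI𝔪 : Ideal.span (Set.range x) ≤ 𝔪)
    (hmem : F' ∈ 𝔪.map (algebraMap R (blowupAlgebra (Ideal.span (Set.range x)) (x i))) ⊔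
      Ideal.span {blowupAlgebra.frac x i j}) :
    a 0 ∈ 𝔪 := by
  -- the polynomial lift `P = Σ a_k T_j^k` and the ideal `K = 𝔪 R[T] + (T_j)`
  set P : MvPolynomial {l : Fin r // l ≠ i} R := ∑ k ∈ Finset.range (m + 1),
    MvPolynomial.C (a k) * MvPolynomial.X (⟨j, hji⟩ : {l : Fin r // l ≠ i}) ^ k with hP
  set K : Ideal (MvPolynomial {l : Fin r // l ≠ i} R) :=
    𝔪.map MvPolynomial.C ⊔ Ideal.span {MvPolynomial.X ⟨j, hji⟩} with hK
  -- `eval P ∈ 𝔪 R[I/z] + (g/z)`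
  have h1 := controlledTransform_sub_sum_mem_span (Ideal.span (Set.range x)) (x i)
    (blowupAlgebra.mem_span_range x j) m a hF hF'
  rw [← eval_sum_C_mul_X_pow x i j hji m a] at h1
  have hzmem : algebraMap R (blowupAlgebra (Ideal.span (Set.range x)) (x i)) (x i) ∈
      𝔪.map (algebraMap R (blowupAlgebra (Ideal.span (Set.range x)) (x i))) ⊔
        Ideal.span {blowupAlgebra.frac x i j} :=
    Ideal.mem_sup_left (Ideal.mem_map_of_mem _ (hI𝔪 (blowupAlgebra.mem_span_range x i)))
  have hevalP : blowupAlgebra.eval x i P ∈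
      𝔪.map (algebraMap R (blowupAlgebra (Ideal.span (Set.range x)) (x i))) ⊔
        Ideal.span {blowupAlgebra.frac x i j} := by
    have h2 : F' - blowupAlgebra.eval x i P ∈
        𝔪.map (algebraMap R (blowupAlgebra (Ideal.span (Set.range x)) (x i))) ⊔
          Ideal.span {blowupAlgebra.frac x i j} :=
      (Ideal.span_singleton_le_iff_mem _).mpr hzmem h1
    have := Ideal.sub_mem _ hmem h2
    rwa [sub_sub_cancel] at this
  -- this ideal is the image of `K` under the surjection `eval`
  have hmapK : K.map (blowupAlgebra.eval x i).toRingHom =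
      𝔪.map (algebraMap R (blowupAlgebra (Ideal.span (Set.range x)) (x i))) ⊔
        Ideal.span {blowupAlgebra.frac x i j} := by
    rw [hK, Ideal.map_sup, Ideal.map_map, Ideal.map_span, Set.image_singleton]
    congr 1
    · congr 1
      ext c
      simp only [RingHom.coe_comp, Function.comp_apply, AlgHom.toRingHom_eq_coe, RingHom.coe_coe,
        blowupAlgebra.eval_C]
    · rw [AlgHom.toRingHom_eq_coe, RingHom.coe_coe, blowupAlgebra.eval_X]
  rw [← hmapK] at hevalP
  have hPK : P ∈ K := by
    have hcomap := Ideal.comap_map_of_surjective (blowupAlgebra.eval x i).toRingHom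
      (blowupAlgebra.eval_surjective x i) K
    have hP' : P ∈ Ideal.comap (blowupAlgebra.eval x i).toRingHom
        (K.map (blowupAlgebra.eval x i).toRingHom) := hevalP
    rw [hcomap] at hP'
    -- `ker eval ⊆ comap (z) = I R[T] ⊆ 𝔪 R[T] ⊆ K`
    have hker : Ideal.comap (blowupAlgebra.eval x i).toRingHom ⊥ ≤ K :=
      calc Ideal.comap (blowupAlgebra.eval x i).toRingHom ⊥
          ≤ Ideal.comap (blowupAlgebra.eval x i).toRingHom
              (Ideal.span {algebraMap R (blowupAlgebra (Ideal.span (Set.range x)) (x i)) (x i)}) :=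
            Ideal.comap_mono bot_le
        _ = (Ideal.span (Set.range x)).map MvPolynomial.C :=
            blowupAlgebra.comap_eval_span_algebraMap_eq x i hx
        _ ≤ K := by rw [hK]; exact le_sup_of_le_left (Ideal.map_mono hI𝔪)
    exact (sup_le le_rfl hker) hP'
  -- constant coefficients: `a₀ = P(0) ∈ 𝔪`
  rw [hK] at hPK
  obtain ⟨q₁, hq₁, q₂, hq₂, hq⟩ := Submodule.mem_sup.mp hPK
  obtain ⟨c, rfl⟩ := Ideal.mem_span_singleton'.mp hq₂
  have hcoeff := congrArg MvPolynomial.constantCoeff hq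
  rw [map_add, map_mul, MvPolynomial.constantCoeff_X, mul_zero, add_zero, hP,
    constantCoeff_sum_C_mul_X_pow i j hji m a] at hcoeff
  rw [← hcoeff, MvPolynomial.constantCoeff_eq]
  exact (MvPolynomial.mem_map_C_iff.mp hq₁) 0

end QuasiRegular

/-! ## Two-element centres `I = (z, g)`: McCoy, and M10 on the chart -/

section TwoGenerators

variable (x : Fin 2 → R) (i j : Fin 2)

/-- Coefficientwise test: `q ↦ 0` in `(R/I)[T]` iff all coefficients of `q` lie in `I`. [folklore] -/
theorem map_mk_eq_zero_iff {σ : Type*} (I : Ideal R) (q : MvPolynomial σ R) :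
    MvPolynomial.map (Ideal.Quotient.mk I) q = 0 ↔ ∀ n, MvPolynomial.coeff n q ∈ I := by
  simp only [MvPolynomial.ext_iff, MvPolynomial.coeff_map, MvPolynomial.coeff_zero,
    Ideal.Quotient.eq_zero_iff_mem]

/-- In `Fin 2`, two elements different from a third one coincide. [folklore] -/
theorem fin_two_eq_of_ne_of_ne : ∀ (i l l' : Fin 2), l ≠ i → l' ≠ i → l = l' := by decide

/-- **The leading form is a non-zero-divisor (McCoy).** For `I = (x₀, x₁)` quasi-regular, `z = xᵢ`,
`g = x_j` (`j ≠ i`): if the coefficients `a₀, …, a_m` of the normal form have no common annihilator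
modulo `I` (`(∀ k, c·a_k ∈ I) ⟹ c ∈ I`; e.g. some `a_k` is a unit, or `R/I` is a domain and some
`a_k ∉ I` — «generic multiplicity exactly `m` along every branch of the trace»), then the controlled
transform `F′` is a non-zero-divisor modulo `(z)`: `F′ c ∈ (z) ⟹ c ∈ (z)`. (Modulo `z` the chart ring
is `(R/I)[T]`, Stacks 0BIQ, and `F′ ↦ Σ ā_k T^k`, a non-zero-divisor by McCoy's theorem.)
[cite: StacksProject, Tag 0BIQ] -/
theorem controlledTransform_regular_mod_of_coeff (hx : IsQuasiRegular x) (hji : j ≠ i)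
    (m : ℕ) (a : ℕ → R) {F : R}
    (hF : F - ∑ k ∈ Finset.range (m + 1), a k * x i ^ (m - k) * x j ^ k ∈
      Ideal.span (Set.range x) ^ (m + 1))
    {F' : blowupAlgebra (Ideal.span (Set.range x)) (x i)}
    (hF' : algebraMap R _ F = algebraMap R _ (x i) ^ m * F')
    (hann : ∀ c : R, (∀ k ∈ Finset.range (m + 1), c * a k ∈ Ideal.span (Set.range x)) →
      c ∈ Ideal.span (Set.range x)) :
    ∀ c : blowupAlgebra (Ideal.span (Set.range x)) (x i),
      F' * c ∈ Ideal.span {algebraMap R (blowupAlgebra (Ideal.span (Set.range x)) (x i)) (x i)} →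
        c ∈ Ideal.span {algebraMap R (blowupAlgebra (Ideal.span (Set.range x)) (x i)) (x i)} := by
  classical
  intro c hc
  obtain ⟨h, rfl⟩ := blowupAlgebra.eval_surjective x i c
  set P : MvPolynomial {l : Fin 2 // l ≠ i} R := ∑ k ∈ Finset.range (m + 1),
    MvPolynomial.C (a k) * MvPolynomial.X (⟨j, hji⟩ : {l : Fin 2 // l ≠ i}) ^ k with hP
  -- `F' ≡ eval P (mod z)`, so `eval (P h) ∈ (z)`
  have h1 := controlledTransform_sub_sum_mem_span (Ideal.span (Set.range x)) (x i)
    (blowupAlgebra.mem_span_range x j) m a hF hF'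
  rw [← eval_sum_C_mul_X_pow x i j hji m a] at h1
  have hPh : blowupAlgebra.eval x i (P * h) ∈
      Ideal.span {algebraMap R (blowupAlgebra (Ideal.span (Set.range x)) (x i)) (x i)} := by
    have e1 : blowupAlgebra.eval x i (P * h) =
        F' * blowupAlgebra.eval x i h - (F' - blowupAlgebra.eval x i P) * blowupAlgebra.eval x i h := by
      rw [map_mul]; ring
    rw [e1]
    exact Ideal.sub_mem _ hc (Ideal.mul_mem_right _ _ h1)
  -- pass to `(R/I)[T]`
  set φ := MvPolynomial.map (σ := {l : Fin 2 // l ≠ i}) (Ideal.Quotient.mk (Ideal.span (Set.range x)))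
    with hφ
  have hPh0 : φ P * φ h = 0 := by
    rw [← map_mul, hφ, map_mk_eq_zero_iff]
    exact (blowupAlgebra.eval_mem_span_algebraMap_iff x i hx _).mp hPh
  -- McCoy in one variable: `φ P` is a non-zero-divisor
  haveI : Unique {l : Fin 2 // l ≠ i} :=
    { default := ⟨j, hji⟩
      uniq := fun l => Subtype.ext (fin_two_eq_of_ne_of_ne i l.1 j l.2 hji) }
  set e := MvPolynomial.uniqueAlgEquiv (R ⧸ Ideal.span (Set.range x)) {l : Fin 2 // l ≠ i} with he
  have hnzd : e (φ P) ∈ nonZeroDivisors (Polynomial (R ⧸ Ideal.span (Set.range x))) := by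
    refine Polynomial.mem_nonZeroDivisors_iff.mpr fun b hb => ?_
    obtain ⟨c, rfl⟩ := Ideal.Quotient.mk_surjective b
    rw [Polynomial.smul_eq_C_mul, ← Polynomial.algebraMap_eq (R := R ⧸ Ideal.span (Set.range x)),
      ← e.commutes, ← map_mul, EmbeddingLike.map_eq_zero_iff, MvPolynomial.algebraMap_eq,
      ← MvPolynomial.map_C (Ideal.Quotient.mk (Ideal.span (Set.range x))) c, hφ, ← map_mul,
      map_mk_eq_zero_iff] at hb
    refine Ideal.Quotient.eq_zero_iff_mem.mpr (hann c fun k hk => ?_)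
    have := hb (Finsupp.single ⟨j, hji⟩ k)
    rwa [MvPolynomial.coeff_C_mul, hP, coeff_sum_C_mul_X_pow i j hji m a hk] at this
  have hh0 : φ h = 0 := by
    have : e (φ h) * e (φ P) = 0 := by rw [← map_mul, mul_comm, hPh0, map_zero]
    have := (mem_nonZeroDivisors_iff_right.mp hnzd) _ this
    exact (EmbeddingLike.map_eq_zero_iff (f := e)).mp this
  rw [hφ, map_mk_eq_zero_iff] at hh0
  exact (blowupAlgebra.eval_mem_span_algebraMap_iff x i hx h).mpr hh0

/-- **M10 `EquimultipleAlongTrace` on the chart.** Let `I = (x₀, x₁) ⊆ R` be quasi-regular, `z = xᵢ`,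
`g = x_j` (`j ≠ i`), `𝔪 ⊇ I` an ideal of `R` (the point `q`), and `F ∈ R` with normal form
`F - Σ_{k ≤ m} a_k z^{m-k} g^k ∈ I^{m+1}` whose coefficients have no common annihilator modulo `I`.
Then on the chart `Spec R[I/z]` of the blow-up of `Spec R` along `V(I)`, the strict transform of the
hypersurface `V(F)` — cut out by the kernel of `R[I/z] → (R/(F))[Ī/z̄]` — passes through the bad point
`b_q = V(𝔪, g/z)` iff `a₀ ∈ 𝔪`: `ker ⊆ 𝔪·R[I/z] + (g/z) ⟺ a₀ ∈ 𝔪`. [OURS · L1 W4.5b; folklore-level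
chart algebra] [cite: StacksProject, Tag 0BIQ] -/
theorem badPoint_mem_strictTransform_iff (hx : IsQuasiRegular x) (hji : j ≠ i)
    (m : ℕ) (a : ℕ → R) {F : R}
    (hF : F - ∑ k ∈ Finset.range (m + 1), a k * x i ^ (m - k) * x j ^ k ∈
      Ideal.span (Set.range x) ^ (m + 1))
    (𝔪 : Ideal R) (hI𝔪 : Ideal.span (Set.range x) ≤ 𝔪)
    (hann : ∀ c : R, (∀ k ∈ Finset.range (m + 1), c * a k ∈ Ideal.span (Set.range x)) →
      c ∈ Ideal.span (Set.range x)) :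
    RingHom.ker (blowupAlgebra.mapQuotient (Ideal.span (Set.range x)) (x i) (Ideal.span {F})) ≤
        𝔪.map (algebraMap R (blowupAlgebra (Ideal.span (Set.range x)) (x i))) ⊔
          Ideal.span {blowupAlgebra.frac x i j} ↔
      a 0 ∈ 𝔪 := by
  obtain ⟨F', hF', -⟩ := exists_controlledTransform_of_normalForm (Ideal.span (Set.range x)) (x i)
    (blowupAlgebra.mem_span_range x j) m a hF
  rw [ker_mapQuotient_eq_span_of_regular_mod _ _ hF'
    (controlledTransform_regular_mod_of_coeff x i j hx hji m a hF hF' hann),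
    Ideal.span_singleton_le_iff_mem]
  exact ⟨coeff_zero_mem_of_controlledTransform_mem x i j hx hji m a hF hF' 𝔪 hI𝔪,
    controlledTransform_mem_badPoint _ _ _ m a hF hF' 𝔪 (hI𝔪 (blowupAlgebra.mem_span_range x i))⟩

end TwoGenerators

/-! ## At a closed point of a regular scheme: multiplicity -/

section Regular

open IsLocalRing

variable [IsRegularLocalRing R] {d : ℕ} (hd : (maximalIdeal R).spanFinrank = d)
  (y : Fin d → R) (hy : Ideal.span (Set.range y) = maximalIdeal R) (i₀ : Fin d)

include hd hy in
/-- **Multiplicity read off the normal form.** `(R, 𝔪)` regular local with regular system of parameters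
`y`, `z = y_{i₀}`, `g ∈ 𝔪²` (the trace `V(z, ḡ)` is singular at the closed point); if
`F ≡ Σ_{k ≤ m} a_k z^{m-k} g^k (mod 𝔪^{m+1})` then `F ∈ 𝔪^{m+1} ⟺ a₀ ∈ 𝔪` — the only possible term of
order `m` is `a₀ z^m`, and `a₀ z^m ∈ 𝔪^{m+1}` forces `a₀ ∈ 𝔪` (Matsumura Thm. 17.10: `gr_𝔪(R)` is a
polynomial ring). So `mult_q(V(F)) ≥ m + 1 ⟺ a₀(q) = 0`. [cite: Matsumura1987, Thm. 17.10] -/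
theorem mem_pow_succ_iff_coeff_zero_mem {g : R} (hg : g ∈ maximalIdeal R ^ 2)
    (m : ℕ) (a : ℕ → R) {F : R}
    (hF : F - ∑ k ∈ Finset.range (m + 1), a k * y i₀ ^ (m - k) * g ^ k ∈ maximalIdeal R ^ (m + 1)) :
    F ∈ maximalIdeal R ^ (m + 1) ↔ a 0 ∈ maximalIdeal R := by
  classical
  have hz : y i₀ ∈ maximalIdeal R := mem_maximalIdeal_of_rsop y hy i₀
  -- the terms with `k ≥ 1` lie in `𝔪^{m+1}`
  have htail : ∑ k ∈ Finset.range m, a (k + 1) * y i₀ ^ (m - (k + 1)) * g ^ (k + 1) ∈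
      maximalIdeal R ^ (m + 1) := by
    refine Ideal.sum_mem _ fun k hk => ?_
    have hkm : k + 1 ≤ m := Finset.mem_range.mp hk
    rw [mul_assoc]
    refine Ideal.mul_mem_left _ _ ?_
    have h1 : y i₀ ^ (m - (k + 1)) ∈ maximalIdeal R ^ (m - (k + 1)) := Ideal.pow_mem_pow hz _
    have h2 : g ^ (k + 1) ∈ maximalIdeal R ^ (2 * (k + 1)) := by
      rw [pow_mul]; exact Ideal.pow_mem_pow hg _
    have h12 := Ideal.mul_mem_mul h1 h2
    rw [← pow_add] at h12
    exact Ideal.pow_le_pow_right (by omega) h12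
  -- `F ≡ a₀ z^m (mod 𝔪^{m+1})`
  have hsplit : F = (F - ∑ k ∈ Finset.range (m + 1), a k * y i₀ ^ (m - k) * g ^ k) +
      ∑ k ∈ Finset.range m, a (k + 1) * y i₀ ^ (m - (k + 1)) * g ^ (k + 1) + a 0 * y i₀ ^ m := by
    rw [Finset.sum_range_succ', Nat.sub_zero, pow_zero, mul_one]; ring
  have hiff : F ∈ maximalIdeal R ^ (m + 1) ↔ a 0 * y i₀ ^ m ∈ maximalIdeal R ^ (m + 1) := by
    constructor
    · intro h
      have e : a 0 * y i₀ ^ m = F - (F - ∑ k ∈ Finset.range (m + 1), a k * y i₀ ^ (m - k) * g ^ k) -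
          ∑ k ∈ Finset.range m, a (k + 1) * y i₀ ^ (m - (k + 1)) * g ^ (k + 1) := by
        linear_combination (-1 : R) * hsplit
      rw [e]
      exact Ideal.sub_mem _ (Ideal.sub_mem _ h hF) htail
    · intro h
      rw [hsplit]
      exact Ideal.add_mem _ (Ideal.add_mem _ hF htail) h
  rw [hiff]
  constructor
  · intro h
    -- quasi-regularity of the regular system of parameters (Matsumura 17.10)
    have hhom : (MvPolynomial.C (a 0) * MvPolynomial.X i₀ ^ m : MvPolynomial (Fin d) R).IsHomogeneous m := by
      have := (MvPolynomial.isHomogeneous_C (Fin d) (a 0)).mul (MvPolynomial.isHomogeneous_X_pow i₀ m)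
      rwa [zero_add] at this
    have heval : MvPolynomial.eval y (MvPolynomial.C (a 0) * MvPolynomial.X i₀ ^ m) ∈
        maximalIdeal R ^ (m + 1) := by
      rwa [map_mul, map_pow, MvPolynomial.eval_C, MvPolynomial.eval_X]
    have hc := coeff_mem_maximalIdeal_of_eval_mem_pow hd y hy hhom heval (Finsupp.single i₀ m)
    rwa [MvPolynomial.coeff_C_mul, MvPolynomial.coeff_X_pow, if_pos rfl, mul_one] at hc
  · intro h
    rw [pow_succ']
    exact Ideal.mul_mem_mul h (Ideal.pow_mem_pow hz m)

include hd hy in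
/-- The two-element centre `(z, g)` with `z` a regular parameter and `g ∉ (z)` is quasi-regular
(`z, g` is an `R`-sequence: `R` and `R/(z)` are domains). [cite: Matsumura1987, Thm. 16.2 (i)] -/
theorem isQuasiRegular_param_pair {g : R} (hgz : g ∉ Ideal.span {y i₀}) :
    IsQuasiRegular ![y i₀, g] := by
  classical
  haveI := isDomain_of_isRegularLocalRing R
  have hz0 : y i₀ ≠ 0 := by
    have := not_mem_span_image_of_not_mem hd y hy (S := ∅) (i := i₀) (Set.notMem_empty _)
    rwa [Set.image_empty, Ideal.span_empty, Ideal.mem_bot] at this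
  have hprime : (Ideal.span {y i₀}).IsPrime := by
    have := isPrime_span_image hd y hy {i₀}
    rwa [Finset.coe_singleton, Set.image_singleton] at this
  refine isQuasiRegular_of_regularSeq 2 _ fun l c hc => ?_
  fin_cases l
  · -- `l = 0`: `z c = 0 ⟹ c = 0`
    have h0 : (![y i₀, g] : Fin 2 → R) '' Set.Iio (0 : Fin 2) = ∅ := by
      rw [Set.image_eq_empty]; ext l; simp
    simp only [Fin.zero_eta] at hc ⊢
    rw [h0, Ideal.span_empty, Ideal.mem_bot] at hc ⊢
    exact (mul_eq_zero.mp hc).resolve_left hz0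
  · -- `l = 1`: `g c ∈ (z) ⟹ c ∈ (z)`
    have h1 : (![y i₀, g] : Fin 2 → R) '' Set.Iio (1 : Fin 2) = {y i₀} := by
      have : Set.Iio (1 : Fin 2) = {0} := by
        ext l; fin_cases l <;> simp
      rw [this, Set.image_singleton]; rfl
    simp only [Fin.mk_one] at hc ⊢
    rw [h1] at hc ⊢
    exact (hprime.mem_or_mem hc).resolve_left hgz

include hd hy in
/-- **M10 `EquimultipleAlongTrace` / AVOID ⟺ EQUIMULTIPLICITY** (tri-1 TRIAGE v3 §−3.B, kernel form).
`(R, 𝔪)` regular local (the threefold germ `P′_k` at `q`) with regular system of parameters `y`,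
`z = y_{i₀}` (the carrier plane), `g ∈ 𝔪²` with `g ∉ (z)` (the trace `D = V(z, g)`, a reduced plane
curve singular at `q`), `I = (z, g)`; `F` (the hypersurface `Y′ ∈ I^m`) in normal form
`F - Σ_{k ≤ m} a_k z^{m-k} g^k ∈ I^{m+1}` with coefficients without common annihilator mod `I` (generic
multiplicity exactly `m` along every branch of `D`). Then on the chart `S = 1` (`g = zT`) of `Bl_D`:
**the bad point `b_q = (𝔪, T)` lies on the strict transform of `Y′` iff `F ∈ 𝔪^{m+1}`, i.e. iff
`mult_q(Y′) ≥ m + 1`** — the strict transform avoids the bad point exactly when `Y′` is equimultiple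
along `D` at `q`. [OURS · L1 W4.5b] [cite: StacksProject, Tag 0BIQ] -/
theorem badPoint_mem_strictTransform_iff_mem_pow_succ {g : R} (hg : g ∈ maximalIdeal R ^ 2)
    (hgz : g ∉ Ideal.span {y i₀}) (m : ℕ) (a : ℕ → R) {F : R}
    (hF : F - ∑ k ∈ Finset.range (m + 1), a k * y i₀ ^ (m - k) * g ^ k ∈
      Ideal.span (Set.range ![y i₀, g]) ^ (m + 1))
    (hann : ∀ c : R, (∀ k ∈ Finset.range (m + 1), c * a k ∈ Ideal.span (Set.range ![y i₀, g])) →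
      c ∈ Ideal.span (Set.range ![y i₀, g])) :
    RingHom.ker (blowupAlgebra.mapQuotient (Ideal.span (Set.range ![y i₀, g])) (y i₀)
          (Ideal.span {F})) ≤
        (maximalIdeal R).map (algebraMap R (blowupAlgebra (Ideal.span (Set.range ![y i₀, g])) (y i₀))) ⊔
          Ideal.span {blowupAlgebra.frac ![y i₀, g] 0 1} ↔
      F ∈ maximalIdeal R ^ (m + 1) := by
  have hx : IsQuasiRegular ![y i₀, g] := isQuasiRegular_param_pair hd y hy i₀ hgz
  have hI𝔪 : Ideal.span (Set.range ![y i₀, g]) ≤ maximalIdeal R := by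
    rw [Ideal.span_le]
    rintro _ ⟨l, rfl⟩
    fin_cases l
    · exact mem_maximalIdeal_of_rsop y hy i₀
    · exact Ideal.pow_le_self two_ne_zero hg
  have hF' : F - ∑ k ∈ Finset.range (m + 1), a k * y i₀ ^ (m - k) * g ^ k ∈
      maximalIdeal R ^ (m + 1) := Ideal.pow_right_mono hI𝔪 _ hF
  exact (badPoint_mem_strictTransform_iff ![y i₀, g] 0 1 hx (by decide) m a hF (maximalIdeal R)
    hI𝔪 hann).trans (mem_pow_succ_iff_coeff_zero_mem hd y hy i₀ hg m a hF').symm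

end Regular

end Summit.ResolutionOfSingularities.ResolutionOfSingularities.Cruxes.EquisingularLiftNat.Sections

end
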